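import Summits.BirchSwinnertonDyer.Rank1Residual.X11b.Three.TamagawaAtomShapes
import Summits.BirchSwinnertonDyer.Rank1Residual.X11b.LocalPointsPrimaryComponent
import Summits.BirchSwinnertonDyer.Rank1Residual.GaloisImage.SmallImageInertiaOrder
import Summits.BirchSwinnertonDyer.Rank1Residual.GaloisImage.GL2F3ExponentEight
import Literature.NumberTheory.EllipticCurves.AdditiveReductionRamifiedTorsionProofs
import Literature.NumberTheory.EllipticCurves.NeronOggShafarevichLocal
import Literature.NumberTheory.EllipticCurves.SerreOpenImageDeterminantProofs
import Literature.NumberTheory.EllipticCurves.SerreOpenImageSupersingularInertiaProofs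
import Literature.NumberTheory.GaloisRepresentations.ModNCyclotomicCharacter
import HarnessLib

/-!
# Crux `CornerAtThree` (item stmt-BirchSwinnertonDyer-19111; routes `ClassRecordThree` ∕ `KolyvaginRoadThree`): the
# TAMAGAWA SHAPE of the (T4″)₃ corner is a THEOREM — no additive prime has `3 ∣ c_ℓ`, `ℓ = 2` included, NO cited input
# (cell `bsd-stepL`, seat `bsd-stepL-corner3-p2` g4 = WIDTH-LEVER lane B; planner g36 RULING 31 (E); `--supports … --as helper`)

HONEST FRAMING: THEOREMS ONLY (no definition, no named fact, no `sorry`); UNCONDITIONAL — proved from the tree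
(Kodaira–Néron over `K_v^nr` from Tate's algorithm, the Weil pairing, Serre's Prop. 15 in the tree's frame of `Aut(E[3])`);
nothing cited as a hypothesis. Not a BSD class theorem; no census label moves (T7); item 19111 is NOT closed.

WHY. Lane B's carrier-inert Shimura road for conjunct 3 (g3: p547646 ∕ p547648 ∕ p550100; g4: p554046) and x11b3's (T2β)@3
Shimura road carry the binder `hshape : ∀ q, 3 ∣ c(E ⊗ ℚ_q) → E split multiplicative at q` (no (T2γ)@3 carrier: no
place of Kodaira type `IV`/`IV*` with `c = 3`). x11b3-p6 (`X11b/Three/CornerShapeGamma.lean`) proved it on the corner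
AWAY FROM `2` GRANTED Serre's inertia order at potentially good `ℓ ≥ 5` (hypothesis `hF`). THIS FILE: whole corner,
every prime, fact-free.

**Theorem.** *`E/ℚ` elliptic, `E[3]` irreducible, `ρ̄_{E,3}` NOT onto ⟹ `3 ∤ c_v(E)` at every additive place `v ∤ 3`.*
PROOF. (1) `G = ρ̄_{E,3}(Γ_ℚ)` has order prime to `3` (Serre Prop. 15; tree
`GaloisImage.not_dvd_card_map_galoisRepTorsion_of_irr_of_not_surj`), so element orders lie in `{1,2,4,8}`
(`GL2F3Cyc.pow_eight_eq_one_or_pow_six_eq_one`). (2) At an ADDITIVE `v ∤ 3` the local inertia group moves a `3`-torsion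
point of `E(K̄_v)` (tree, from Kodaira–Néron over `K_v^nr`: `exists_inertia_smul_ne_of_hasAdditiveReductionAt`). (3) `χ̄₃`
is unramified at `v ∤ 3` (`modNCyclotomicCharacter_eq_one_of_mem_inertia`), so `det ρ̄ = 1` on inertia (Weil pairing,
`exists_frame_galoisRepTorsion_rat`). (4) In `GL₂(𝔽₃)` an involution of determinant `1` is `−1` (§1, `decide` on the
entries), so SOME INERTIA ELEMENT ACTS AS `−1` ON `E[3]` (§2). (5) If `3 ∣ c_v`, Cauchy in `E(ℚ_v)/E₀(ℚ_v)` and Silverman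
VII.6.3 in the tree's form (`AcSelmer.exists_torsion_sub_mem_nonsingularReductionSubgroup`) give a `ℚ_v`-rational point of
order `3`, a `Γ_{ℚ_v}`-fixed non-zero `3`-torsion point of `E(K̄_v)` — negated by (4): `P = 0`, absurd (§3). Hence NO
(T2γ)@3 place on the corner of X11b@3 (`Three.not_shapeGamma_of_not_surj`, §4) and `hshape` HOLDS there
(`Three.hasSplitMultiplicativeReductionAtPrime_of_three_dvd_of_not_surj`, via x11b3's interface). This discharges the
`hshape` binder of `Three.corner_missingUpperBoundAt_of_{inertSet,splitSet,admissibleSet}` (p550100) and makes the first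
conjunct of `X11b.Three.CornerInertAdmissible` (p554046) automatic on the corner (sequel file); it supersedes x11b3-p6's
`Three.shapeGamma_over_two_of_not_surj` (granted `hF`, `ℓ = 2` excluded). Census consistency (EVIDENCE, kits j122802 ∕
j284022, 296 corner pairs N < 5·10⁵): hshape 208∕208, no type `IV`/`IV*` anywhere — now a theorem.

References: [SilvermanAEC2009] Thm. VII.6.1, Prop. VII.6.3, proof of Thm. VII.7.1, III.8; [Serre1972] §1.11, §2.4 Prop. 15,
§2.5–2.6; [SilvermanATAEC1994] IV.9 Table 4.1; memo CORNER3-G3.md §6 (H); planner g36 RULING 31 (E) (STATUS 2026-08-27T17:36:33Z).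
-/

set_option linter.dupNamespace false
set_option autoImplicit false

noncomputable section

open scoped Classical NumberField NNReal

open WeierstrassCurve NumberField IsDedekindDomain Field Matrix
  Literature.NumberTheory.EllipticCurves Literature.NumberTheory.GaloisRepresentations
  Literature.NumberTheory.EllipticCurves.Rank1Residual Rat.HeightOneSpectrum
  IsDedekindDomain.HeightOneSpectrum

/-! ### §1. Two facts about `GL₂(𝔽₃)` (kernel `decide` on the four entries) -/

namespace Summit.BirchSwinnertonDyer.BirchSwinnertonDyer.Theorems.CornerShape

/-- The entry-wise certificate: over `𝔽₃`, `A² = 1` and `det A = 1` force `A = ±1` (`3⁴` cases). [folklore] -/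
private theorem entries_of_sq_eq_one_of_det_eq_one :
    ∀ a b c d : ZMod 3, a * d - b * c = 1 →
      a * a + b * c = 1 → a * b + b * d = 0 → c * a + d * c = 0 → c * b + d * d = 1 →
      (a = 1 ∧ b = 0 ∧ c = 0 ∧ d = 1) ∨ (a = -1 ∧ b = 0 ∧ c = 0 ∧ d = -1) := by
  decide

/-- **An involution of `GL₂(𝔽₃)` of determinant `1` is `±1`** (the 2-Sylow of `SL₂(𝔽₃)` is quaternion, with unique
involution `−1`). [cite: Serre1972, §2.5] -/
theorem eq_one_or_eq_neg_one_of_mul_self_eq_one {M : GL (Fin 2) (ZMod 3)} (h2 : M * M = 1)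
    (hdet : Matrix.GeneralLinearGroup.det M = 1) : M = 1 ∨ M = -1 := by
  have hd : (M : Matrix (Fin 2) (Fin 2) (ZMod 3)).det = 1 := by
    rw [← Matrix.GeneralLinearGroup.val_det_apply, hdet, Units.val_one]
  have hm : (M : Matrix (Fin 2) (Fin 2) (ZMod 3)) * (M : Matrix (Fin 2) (Fin 2) (ZMod 3)) = 1 := by
    rw [← Units.val_mul, h2, Units.val_one]
  set A : Matrix (Fin 2) (Fin 2) (ZMod 3) := (M : Matrix (Fin 2) (Fin 2) (ZMod 3)) with hA
  rw [Matrix.det_fin_two] at hd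
  have h00 := congr_fun (congr_fun hm 0) 0
  have h01 := congr_fun (congr_fun hm 0) 1
  have h10 := congr_fun (congr_fun hm 1) 0
  have h11 := congr_fun (congr_fun hm 1) 1
  simp only [Matrix.mul_apply, Fin.sum_univ_two, Matrix.one_apply, Fin.isValue, if_true, one_ne_zero,
    zero_ne_one, if_false] at h00 h01 h10 h11
  rcases entries_of_sq_eq_one_of_det_eq_one (A 0 0) (A 0 1) (A 1 0) (A 1 1) hd h00 h01 h10 h11 with
    ⟨ha, hb, hc, hd'⟩ | ⟨ha, hb, hc, hd'⟩
  · left; apply Units.ext; ext i j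
    fin_cases i <;> fin_cases j <;> simp [← hA, ha, hb, hc, hd']
  · right; apply Units.ext; rw [Units.val_neg, Units.val_one]; ext i j
    fin_cases i <;> fin_cases j <;> simp [← hA, ha, hb, hc, hd']

/-- **An element `M ≠ 1` of `GL₂(𝔽₃)` of order prime to `3`, all of whose powers have determinant `1`, has a power
equal to `−1`.** Its order divides `8` or `6` (`GL2F3Cyc.pow_eight_eq_one_or_pow_six_eq_one`) and is prime to `3`,
hence is `2`, `4` or `8`; the power of order `2` is an involution of determinant `1`, i.e. `−1`.
[cite: Serre1972, §2.5–2.6 (element orders of GL₂(𝔽₃): 1, 2, 3, 4, 6, 8)] -/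
theorem exists_pow_eq_neg_one {M : GL (Fin 2) (ZMod 3)} (hne : M ≠ 1) (h3 : ¬ 3 ∣ orderOf M)
    (hdet : ∀ k : ℕ, Matrix.GeneralLinearGroup.det (M ^ k) = 1) : ∃ k : ℕ, M ^ k = -1 := by
  have hdet1 : Matrix.GeneralLinearGroup.det M = 1 := by simpa using hdet 1
  have hord1 : orderOf M ≠ 1 := fun h ↦ hne (orderOf_eq_one_iff.mp h)
  -- an involution of determinant one among the powers of `M`
  have hinv : ∀ k : ℕ, M ^ k ≠ 1 → M ^ k * M ^ k = 1 → ∃ j : ℕ, M ^ j = -1 := by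
    intro k hk1 hkk
    exact (eq_one_or_eq_neg_one_of_mul_self_eq_one hkk (hdet k)).elim (fun h ↦ absurd h hk1) fun h ↦ ⟨k, h⟩
  rcases Summit.BirchSwinnertonDyer.Rank1Residual.GaloisImage.GL2F3Cyc.pow_eight_eq_one_or_pow_six_eq_one M with
    h8 | h6
  · -- order divides `8`
    have hfin : IsOfFinOrder M := isOfFinOrder_iff_pow_eq_one.mpr ⟨8, by norm_num, h8⟩
    have hpos : 0 < orderOf M := hfin.orderOf_pos
    have hdvd : orderOf M ∣ 8 := orderOf_dvd_of_pow_eq_one h8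
    have hle : orderOf M ≤ 8 := Nat.le_of_dvd (by norm_num) hdvd
    interval_cases h : orderOf M
    · exact absurd rfl hord1
    · exact hinv 1 (by rwa [pow_one]) (by rw [← pow_add]; simpa [h] using pow_orderOf_eq_one M)
    · exact absurd (dvd_refl 3) h3
    · exact hinv 2 (pow_ne_one_of_lt_orderOf (by norm_num) (by omega))
        (by rw [← pow_add]; simpa [h] using pow_orderOf_eq_one M)
    · exfalso; omega
    · exfalso; omega
    · exfalso; omega
    · exact hinv 4 (pow_ne_one_of_lt_orderOf (by norm_num) (by omega))
        (by rw [← pow_add]; simpa [h] using pow_orderOf_eq_one M)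
  · -- order divides `6`, prime to `3`: order `2`
    have hfin : IsOfFinOrder M := isOfFinOrder_iff_pow_eq_one.mpr ⟨6, by norm_num, h6⟩
    have hpos : 0 < orderOf M := hfin.orderOf_pos
    have hdvd : orderOf M ∣ 6 := orderOf_dvd_of_pow_eq_one h6
    have hle : orderOf M ≤ 6 := Nat.le_of_dvd (by norm_num) hdvd
    interval_cases h : orderOf M
    · exact absurd rfl hord1
    · exact hinv 1 (by rwa [pow_one]) (by rw [← pow_add]; simpa [h] using pow_orderOf_eq_one M)
    · exact absurd (dvd_refl 3) h3
    · exfalso; omega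
    · exfalso; omega
    · exact absurd (by norm_num : 3 ∣ 6) h3

end Summit.BirchSwinnertonDyer.BirchSwinnertonDyer.Theorems.CornerShape

/-! ### §2. On the corner, some inertia element at an additive `v ∤ 3` acts as `−1` on `E[3]` -/

namespace Summit.BirchSwinnertonDyer.BirchSwinnertonDyer.Theorems

open Summit.BirchSwinnertonDyer.BirchSwinnertonDyer.Theorems.CornerShape

/-- In the tree's frame `(e, Φ)` of `Aut(E[3])`: a Galois element whose matrix is `−1` negates `E[3]`. [folklore] -/
private theorem smul_eq_neg_of_frame_eq_neg_one (W : WeierstrassCurve ℚ)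
    (e : geomTorsion W ((3 : ℕ) : ℤ) ≃+ (Fin 2 → ZMod 3))
    (Φ : Multiplicative (AddAut (geomTorsion W ((3 : ℕ) : ℤ))) ≃* GL (Fin 2) (ZMod 3))
    (he : ∀ (g : Multiplicative (AddAut (geomTorsion W ((3 : ℕ) : ℤ)))) (x : geomTorsion W ((3 : ℕ) : ℤ)),
      e (Multiplicative.toAdd g x) = ((Φ g : GL (Fin 2) (ZMod 3)) : Matrix (Fin 2) (Fin 2) (ZMod 3)) *ᵥ e x)
    {τ : absoluteGaloisGroup ℚ} (hτ : Φ (galoisRepTorsion W ((3 : ℕ) : ℤ) τ) = -1)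
    (P : geomTorsion W ((3 : ℕ) : ℤ)) : τ • P = -P := by
  have h := he (galoisRepTorsion W ((3 : ℕ) : ℤ) τ) P
  rw [hτ, Units.val_neg, Units.val_one, Matrix.neg_mulVec, Matrix.one_mulVec, ← map_neg] at h
  have h' : Multiplicative.toAdd (galoisRepTorsion W ((3 : ℕ) : ℤ) τ) P = -P := e.injective h
  rwa [galoisRepTorsion_apply] at h'

/-- `n ∈ v ↔ q_v ∣ n` for a natural number `n` and a finite place `v` of `ℚ` (`q_v = primesEquiv v`). [folklore] -/
private theorem natCast_mem_asIdeal_iff_primesEquiv_dvd (v : HeightOneSpectrum (𝓞 ℚ)) (n : ℕ) :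
    (n : 𝓞 ℚ) ∈ v.asIdeal ↔ (primesEquiv v : ℕ) ∣ n := by
  rw [show ((primesEquiv v : Nat.Primes) : ℕ) = natGenerator v from rfl, natGenerator_dvd_iff,
    ← map_natCast (Rat.IsIntegralClosure.intEquiv (𝓞 ℚ)) n, Ideal.apply_mem_of_equiv_iff]

/-- A prime `𝔓` of `\bar ℤ` above a place `v ∌ n` does not contain `n`. [folklore] -/
private theorem natCast_not_mem_of_mem_primesAbove' {v : HeightOneSpectrum (𝓞 ℚ)} {n : ℕ}
    (hv : (n : 𝓞 ℚ) ∉ v.asIdeal) {𝔓 : Ideal (absIntegers (𝓞 ℚ) ℚ)} (h𝔓 : 𝔓 ∈ v.primesAbove) :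
    (n : absIntegers (𝓞 ℚ) ℚ) ∉ 𝔓 := by
  intro hmem
  apply hv
  have h1 : (n : 𝓞 ℚ) ∈ 𝔓.under (𝓞 ℚ) := by
    rw [Ideal.under_def, Ideal.mem_comap, map_natCast]
    exact hmem
  rwa [← h𝔓.2.over] at h1

/-- **On the corner, at an additive place `v ∤ 3` some local INERTIA element acts as `−1` on `E[3]`.** For `E/ℚ`
elliptic with `E[3]` irreducible and `ρ̄_{E,3}` not onto, a finite place `v ∤ 3` of additive reduction and a prime
`𝔐` of the local absolute integers above `v`: some `τ ∈ I_𝔐 ≤ Γ_{ℚ_v}` restricts (along the chosen embedding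
`ℚ̄ → ℚ̄_v`) to an element of `Γ_ℚ` negating every `3`-torsion point (steps (1)–(4) of the module docstring). UNCONDITIONAL. [cite: SilvermanAEC2009, Thm. VII.6.1 and proof of Thm. VII.7.1 (PDF pp. 177–179)]
[cite: Serre1972, §1.11, §2.4 Prop. 15, §2.5] -/
theorem Three.exists_inertia_resGal_smul_eq_neg_of_hasAdditiveReductionAt (W : WeierstrassCurve ℚ) [W.IsElliptic]
    [Fact (Nat.Prime 3)] (hirr : Irr W 3) (hns : ¬ Surj W 3) {v : HeightOneSpectrum (𝓞 ℚ)}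
    (hv3 : ((3 : ℕ) : 𝓞 ℚ) ∉ v.asIdeal) (hadd : W.HasAdditiveReductionAt v)
    {𝔐 : Ideal v.localAbsIntegers} (h𝔐 : 𝔐 ∈ v.localPrimesAbove) :
    ∃ τ ∈ 𝔐.inertia (absoluteGaloisGroup (v.adicCompletion ℚ)),
      ∀ P : geomTorsion W ((3 : ℕ) : ℤ), resGal (K := ℚ) (v.adicCompletion ℚ) τ • P = -P := by
  obtain ⟨w, hw⟩ := v.exists_spectralValuation
  -- (2) inertia moves a `3`-torsion point of `E(K̄_v)`; transport it to `E(ℚ̄)[3]`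
  obtain ⟨σ, hσI, Q, h3Q, hσQ⟩ :=
    W.exists_inertia_smul_ne_of_hasAdditiveReductionAt hadd Nat.prime_three le_rfl hv3 hw h𝔐
  obtain ⟨P₀, h3P₀, hP₀Q⟩ := exists_pointsMapOfEmb_eq_of_nsmul_eq_zero W
    (closureEmb (K := ℚ) (v.adicCompletion ℚ)) (by norm_num : (3 : ℕ) ≠ 0) h3Q
  set ρ := galoisRepTorsion W ((3 : ℕ) : ℤ) with hρ
  set τ₀ : absoluteGaloisGroup ℚ := resGal (K := ℚ) (v.adicCompletion ℚ) σ with hτ₀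
  have hP₀mem : P₀ ∈ geomTorsion W ((3 : ℕ) : ℤ) :=
    (Submodule.mem_torsionBy_iff _ _).mpr (show ((3 : ℕ) : ℤ) • P₀ = 0 by rw [natCast_zsmul, h3P₀])
  have hg₀ : ρ τ₀ ≠ 1 := by
    intro h1
    have h := (galoisRepTorsion_eq_one_iff' W (((3 : ℕ) : ℤ)) τ₀).mp h1 ⟨P₀, hP₀mem⟩
    have h' : τ₀ • P₀ = P₀ := by
      simpa [Literature.NumberTheory.EllipticCurves.AddSubgroup.torsionBy.coe_smul] using congrArg Subtype.val h
    apply hσQ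
    rw [← hP₀Q]
    change σ • pointsMap W (v.adicCompletion ℚ) P₀ = pointsMap W (v.adicCompletion ℚ) P₀
    rw [← pointsMap_smul, ← hτ₀, h']
  -- (1) the frame and the order of the image
  obtain ⟨e, Φ, he, -, hdet, -⟩ := exists_frame_galoisRepTorsion_rat W 3
  have hcard : ¬ 3 ∣ Nat.card ((⊤ : Subgroup (absoluteGaloisGroup ℚ)).map ρ) :=
    Summit.BirchSwinnertonDyer.Rank1Residual.GaloisImage.not_dvd_card_map_galoisRepTorsion_of_irr_of_not_surj
      W 3 hirr hns ⊤
  have hord : ¬ 3 ∣ orderOf (Φ (ρ τ₀)) := by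
    rw [MulEquiv.orderOf_eq Φ (ρ τ₀)]
    exact fun h ↦ hcard (h.trans (Subgroup.orderOf_dvd_natCard _ ⟨τ₀, Subgroup.mem_top _, rfl⟩))
  have hne : Φ (ρ τ₀) ≠ 1 := fun h ↦ hg₀ (Φ.injective (by rw [h, map_one]))
  -- (3) `det = χ̄₃ = 1` on the inertia group at `v ∤ 3`
  set 𝔓 := v.primeBelow (closureEmb (K := ℚ) (v.adicCompletion ℚ)) 𝔐 with h𝔓def
  have h𝔓 : 𝔓 ∈ v.primesAbove := primeBelow_mem_primesAbove h𝔐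
  haveI : 𝔓.IsPrime := h𝔓.1
  haveI : NeZero ((3 : ℕ) : ℚ) := ⟨by norm_num⟩
  have hdetI : ∀ τ ∈ 𝔐.inertia (absoluteGaloisGroup (v.adicCompletion ℚ)),
      Matrix.GeneralLinearGroup.det (Φ (ρ (resGal (K := ℚ) (v.adicCompletion ℚ) τ))) = 1 := by
    intro τ hτ
    rw [hdet, modPCyclotomicCharacterZMod_eq_modNCyclotomicCharacter]
    have hτI : resGal (K := ℚ) (v.adicCompletion ℚ) τ ∈ 𝔓.inertia (absoluteGaloisGroup ℚ) := by
      rw [resGal_eq]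
      exact resGalOfEmb_mem_inertia_primeBelow v _ 𝔐 hτ
    exact modNCyclotomicCharacter_eq_one_of_mem_inertia (K := ℚ) (N := 3)
      (natCast_not_mem_of_mem_primesAbove' hv3 h𝔓) hτI
  -- (4) a power of `Φ ρ(res σ)` is `−1`
  have hdetpow : ∀ k : ℕ, Matrix.GeneralLinearGroup.det (Φ (ρ τ₀) ^ k) = 1 := by
    intro k
    rw [← map_pow, ← map_pow, hτ₀, ← map_pow]
    exact hdetI _ (Subgroup.pow_mem _ hσI k)
  obtain ⟨k, hk⟩ := exists_pow_eq_neg_one hne hord hdetpow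
  refine ⟨σ ^ k, Subgroup.pow_mem _ hσI k, fun P ↦ ?_⟩
  have hk' : Φ (ρ (resGal (K := ℚ) (v.adicCompletion ℚ) (σ ^ k))) = -1 := by
    rw [map_pow, ← hτ₀, map_pow, map_pow, hk]
  exact smul_eq_neg_of_frame_eq_neg_one W e Φ he hk' P

/-! ### §3. `3 ∤ c_v` at every additive `v ∤ 3` on the corner -/

/-- In an additive group, a non-zero element killed by a power of a prime `p` yields a non-zero element killed by `p`.
[folklore] -/
private theorem exists_ne_zero_nsmul_eq_zero_of_pow {A : Type*} [AddCommGroup A] {p : ℕ} {t : A} (ht : t ≠ 0) :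
    ∀ s : ℕ, p ^ s • t = 0 → ∃ t₁ : A, t₁ ≠ 0 ∧ p • t₁ = 0 := by
  intro s
  induction s with
  | zero => intro h; rw [pow_zero, one_smul] at h; exact absurd h ht
  | succ s ih =>
    intro h
    by_cases hs : p ^ s • t = 0
    · exact ih hs
    · exact ⟨p ^ s • t, hs, by rw [← mul_nsmul', ← pow_succ', h]⟩

/-- **On the corner, `3 ∤ c_v(E)` at every additive place `v ∤ 3`.** For `E/ℚ` elliptic with `E[3]` irreducible and
`ρ̄_{E,3}` not onto and a finite place `v ∤ 3` of additive reduction: `3 ∤ c_v = [E(ℚ_v) : E₀(ℚ_v)]`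
(`W.tamagawaNumberAt v`): step (5) of the module docstring (Cauchy in `X(ℚ_v)/X₀(ℚ_v)`, Silverman VII.6.3 in the tree's
form `AcSelmer.exists_torsion_sub_mem_nonsingularReductionSubgroup`, transport `exists_addEquiv_localPoints_of_smul_eq` /
`exists_pointsMapOfEmb_eq_of_nsmul_eq_zero`, and §2). UNCONDITIONAL; no Tate-algorithm case, `v ∣ 2` included. [cite: SilvermanAEC2009, Thm. VII.6.1, Prop. VII.6.3, proof of Thm. VII.7.1]
[cite: Serre1972, §2.4 Prop. 15 and §2.5] -/
theorem Three.not_three_dvd_tamagawaNumberAt_of_hasAdditiveReductionAt_of_not_surj (W : WeierstrassCurve ℚ)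
    [W.IsElliptic] [Fact (Nat.Prime 3)] (hirr : Irr W 3) (hns : ¬ Surj W 3) {v : HeightOneSpectrum (𝓞 ℚ)}
    (hv3 : ((3 : ℕ) : 𝓞 ℚ) ∉ v.asIdeal) (hadd : W.HasAdditiveReductionAt v) :
    ¬ 3 ∣ W.tamagawaNumberAt v := by
  intro h3c
  obtain ⟨𝔐, h𝔐⟩ := v.localPrimesAbove_nonempty
  obtain ⟨τ, hτI, hτ⟩ :=
    Three.exists_inertia_resGal_smul_eq_neg_of_hasAdditiveReductionAt W hirr hns hv3 hadd h𝔐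
  set J := W.localMinimalIntegralModel v with hJdef
  set X : WeierstrassCurve (v.adicCompletion ℚ) :=
    J.map (algebraMap (v.adicCompletionIntegers ℚ) (v.adicCompletion ℚ)) with hXdef
  set E₀K : AddSubgroup X.toAffine.Point := J.nonsingularReductionSubgroup
    (integers_valuationRing_valuation (v.adicCompletionIntegers ℚ) (v.adicCompletion ℚ)) with hE₀K
  haveI hXell : X.IsElliptic := W.isElliptic_map_localMinimalIntegralModel (v := v)
  have hidx : E₀K.index = W.tamagawaNumberAt v :=
    (Summit.BirchSwinnertonDyer.Rank1Residual.X11b.AcSelmer.localTamagawaNumber_eq_index_nonsingularReductionSubgroup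
      (W := W) (v := v)).symm
  have hidx0 : E₀K.index ≠ 0 := by
    rw [hidx, tamagawaNumberAt_def]; exact W.localTamagawaNumber_baseChange_ne_zero v
  haveI : E₀K.FiniteIndex := ⟨hidx0⟩
  have h3card : 3 ∣ Nat.card (X.toAffine.Point ⧸ E₀K) := by rw [← AddSubgroup.index_eq_card, hidx]; exact h3c
  obtain ⟨xbar, hxbar⟩ := exists_prime_addOrderOf_dvd_card' (G := X.toAffine.Point ⧸ E₀K) 3 h3card
  obtain ⟨x, rfl⟩ := QuotientAddGroup.mk_surjective xbar
  have hx : x ∉ E₀K := by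
    intro hx
    have h0 : (x : X.toAffine.Point ⧸ E₀K) = 0 := (QuotientAddGroup.eq_zero_iff x).mpr hx
    rw [h0, addOrderOf_zero] at hxbar
    exact absurd hxbar (by norm_num)
  have h3x : 3 ^ 1 • x ∈ E₀K := by
    rw [pow_one, ← QuotientAddGroup.eq_zero_iff, QuotientAddGroup.mk_nsmul, ← hxbar]
    exact addOrderOf_nsmul_eq_zero _
  obtain ⟨t, ⟨s, hs⟩, htx⟩ : ∃ t : X.toAffine.Point, (∃ s : ℕ, 3 ^ s • t = 0) ∧ t - x ∈ E₀K :=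
    Summit.BirchSwinnertonDyer.Rank1Residual.X11b.AcSelmer.exists_torsion_sub_mem_nonsingularReductionSubgroup
      W hv3 x ⟨1, h3x⟩
  have ht0 : t ≠ 0 := by
    rintro rfl
    apply hx
    have : -(0 - x) ∈ E₀K := E₀K.neg_mem htx
    simpa using this
  obtain ⟨t₁, ht₁0, h3t₁⟩ := exists_ne_zero_nsmul_eq_zero_of_pow ht0 s hs
  have hJ : X = W.localMinimalModel v :=
    WeierstrassCurve.baseChange_integralModel_eq (v.adicCompletionIntegers ℚ) (W.localMinimalModel v)
  obtain ⟨C, hC⟩ := W.exists_variableChange_smul_eq_localMinimalModel v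
  obtain ⟨Φ, hΦ⟩ := W.exists_addEquiv_localPoints_of_smul_eq v (hC.trans hJ.symm)
  -- `X ⊗_{ℚ_v} ℚ_v = X` (so that `Affine.Point.map (Algebra.ofId ℚ_v ℚ̄_v)` is defined on `X(ℚ_v)`)
  have hself : X.baseChange (v.adicCompletion ℚ) = X := by
    change (J.map _).map (algebraMap (v.adicCompletion ℚ) (v.adicCompletion ℚ)) = J.map _
    rw [Algebra.algebraMap_self, WeierstrassCurve.map_id]
  set P₁ : (X.baseChange (v.adicCompletion ℚ)).toAffine.Point := Affine.Point.congrEquiv hself.symm t₁ with hP₁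
  set R : (X.baseChange (AlgebraicClosure (v.adicCompletion ℚ))).toAffine.Point :=
    Affine.Point.map (W' := X) (Algebra.ofId (v.adicCompletion ℚ) (AlgebraicClosure (v.adicCompletion ℚ))) P₁
    with hR
  have hR0 : R ≠ 0 := by
    intro h
    apply ht₁0
    have h1 : P₁ = 0 := Affine.Point.map_injective (W' := X)
      (Algebra.ofId (v.adicCompletion ℚ) (AlgebraicClosure (v.adicCompletion ℚ))) (by rw [← hR, h, map_zero])
    exact (Affine.Point.congrEquiv hself.symm).injective (by rw [← hP₁, h1, map_zero])
  have h3R : 3 • R = 0 := by rw [hR, ← map_nsmul, hP₁, ← map_nsmul, h3t₁, map_zero, map_zero]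
  have hRfix : ∀ γ : absoluteGaloisGroup (v.adicCompletion ℚ),
      Affine.Point.map ((absoluteGaloisGroup.toAlgEquiv _ γ :
          AlgebraicClosure (v.adicCompletion ℚ) ≃ₐ[v.adicCompletion ℚ] AlgebraicClosure (v.adicCompletion ℚ)) :
          AlgebraicClosure (v.adicCompletion ℚ) →ₐ[v.adicCompletion ℚ] AlgebraicClosure (v.adicCompletion ℚ)) R = R := by
    intro γ
    rw [hR, Affine.Point.map_map, Algebra.comp_ofId]
  set Qv : localPoints W (v.adicCompletion ℚ) := Φ.symm R with hQv
  have hQv0 : Qv ≠ 0 := fun h ↦ hR0 (by rw [← Φ.apply_symm_apply R, ← hQv, h, map_zero])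
  have h3Qv : 3 • Qv = 0 := Φ.injective (by rw [map_nsmul, hQv, AddEquiv.apply_symm_apply, h3R, map_zero])
  have hQvfix : ∀ γ : absoluteGaloisGroup (v.adicCompletion ℚ), γ • Qv = Qv := fun γ ↦
    Φ.injective (by rw [hΦ, hQv, AddEquiv.apply_symm_apply, hRfix])
  obtain ⟨P₀, h3P₀, hP₀Q⟩ := exists_pointsMapOfEmb_eq_of_nsmul_eq_zero W
    (closureEmb (K := ℚ) (v.adicCompletion ℚ)) (by norm_num : (3 : ℕ) ≠ 0) h3Qv
  have hP₀mem : P₀ ∈ geomTorsion W ((3 : ℕ) : ℤ) :=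
    (Submodule.mem_torsionBy_iff _ _).mpr (show ((3 : ℕ) : ℤ) • P₀ = 0 by rw [natCast_zsmul, h3P₀])
  have hP₀fix : resGal (K := ℚ) (v.adicCompletion ℚ) τ • P₀ = P₀ := by
    apply pointsMapOfEmb_injective W (closureEmb (K := ℚ) (v.adicCompletion ℚ))
    change pointsMap W (v.adicCompletion ℚ) (resGal (K := ℚ) (v.adicCompletion ℚ) τ • P₀) =
      pointsMap W (v.adicCompletion ℚ) P₀
    rw [pointsMap_smul]
    change τ • pointsMapOfEmb W (closureEmb (K := ℚ) (v.adicCompletion ℚ)) P₀ =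
      pointsMapOfEmb W (closureEmb (K := ℚ) (v.adicCompletion ℚ)) P₀
    rw [hP₀Q, hQvfix]
  have hneg := hτ ⟨P₀, hP₀mem⟩
  have hneg' : resGal (K := ℚ) (v.adicCompletion ℚ) τ • P₀ = -P₀ := by
    simpa [Literature.NumberTheory.EllipticCurves.AddSubgroup.torsionBy.coe_smul] using congrArg Subtype.val hneg
  rw [hP₀fix] at hneg'
  -- `P₀ = -P₀` and `3 P₀ = 0` force `P₀ = 0`
  have h2 : P₀ + P₀ = 0 := by nth_rw 2 [hneg']; exact add_neg_cancel P₀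
  have hP₀0 : P₀ = 0 := by
    have h := h3P₀
    rwa [show (3 : ℕ) = 2 + 1 from rfl, succ_nsmul, two_nsmul, h2, zero_add] at h
  apply hQv0
  rw [← hP₀Q, hP₀0, map_zero]

end Summit.BirchSwinnertonDyer.BirchSwinnertonDyer.Theorems

/-! ### §4. No (T2γ)@3 place on the corner; the Tamagawa SHAPE `hshape` is a theorem there -/

namespace Summit.BirchSwinnertonDyer.BirchSwinnertonDyer.Theorems

open Summit.BirchSwinnertonDyer.Rank1Residual Summit.BirchSwinnertonDyer.Rank1Residual.X11b
  Summit.BirchSwinnertonDyer.Rank1Residual.X11b.Three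

/-- **On the (T4″)₃ corner there is NO (T2γ)@3 place: `ClassX11b W 3 → ¬ Surj W 3 → ¬ ShapeGamma W`.** A (T2γ)@3
place `v` has Kodaira type `IV`/`IV*` and `c_v = 3`; it lies over `ℓ ≠ 3` (multiplicative at `3`,
`primesEquiv_ne_three_of_typeIV`) and is additive (`not_good_not_mult_of_kodairaSymbolAt_IV`), so
`Three.not_three_dvd_tamagawaNumberAt_of_hasAdditiveReductionAt_of_not_surj` forbids `3 ∣ c_v`. Supersedes x11b3-p6's
`Three.shapeGamma_over_two_of_not_surj` (granted Serre's `hF`, `ℓ = 2` excluded): UNCONDITIONAL, `ℓ = 2` included.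
[cite: SilvermanAEC2009, Thm. VII.6.1 and proof of Thm. VII.7.1] [cite: Serre1972, §2.4 Prop. 15 and §2.5]
[cite: SilvermanATAEC1994, IV.9.4 Steps 5 and 8, Table 4.1] -/
theorem Three.not_shapeGamma_of_not_surj (W : WeierstrassCurve ℚ) [W.IsElliptic] [W.IsGloballyMinimal]
    [Fact (Nat.Prime 3)] (hX : ClassX11b W 3) (hns : ¬ Surj W 3) : ¬ ShapeGamma W := by
  rintro ⟨v, hk, hc⟩
  have h3 : (primesEquiv v : ℕ) ≠ 3 := primesEquiv_ne_three_of_typeIV W hX hk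
  have hv3 : ((3 : ℕ) : 𝓞 ℚ) ∉ v.asIdeal := by
    rw [natCast_mem_asIdeal_iff_primesEquiv_dvd]
    intro h
    exact h3 ((Nat.prime_dvd_prime_iff_eq (primesEquiv v).2 Nat.prime_three).mp h)
  obtain ⟨hng, hnm⟩ := not_good_not_mult_of_kodairaSymbolAt_IV W v hk
  have hadd : W.HasAdditiveReductionAt v := by
    rcases W.hasGoodReductionAt_or_hasMultiplicativeReductionAt_or_hasAdditiveReductionAt v with h | h | h
    exacts [absurd h hng, absurd h hnm, h]
  exact Three.not_three_dvd_tamagawaNumberAt_of_hasAdditiveReductionAt_of_not_surj W hX.2.2.2 hns hv3 hadd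
    (by rw [hc])

/-- **The Tamagawa SHAPE of the corner is a theorem: at every prime `q`, `3 ∣ c(E ⊗ ℚ_q)` forces SPLIT multiplicative
reduction** — the binder `hshape` of the carrier-inert Shimura road (`Three.corner_missingUpperBoundAt_of_{inertSet,
splitSet,admissibleSet}`, p550100; `…EulerHalvesAtThreeShimuraInert`, p550099) and of x11b3's (T2β)@3 Shimura road,
DISCHARGED on the corner `ClassX11b W 3 ∧ ¬ Surj W 3` (x11b3's interface
`hasSplitMultiplicativeReductionAtPrime_of_three_dvd_of_not_shapeGamma` on `Three.not_shapeGamma_of_not_surj`). UNCONDITIONAL.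
[cite: SilvermanAEC2009, Thm. VII.6.1 and VII.6 Ex. 7.6] [cite: Serre1972, §2.4 Prop. 15] -/
theorem Three.hasSplitMultiplicativeReductionAtPrime_of_three_dvd_of_not_surj (W : WeierstrassCurve ℚ) [W.IsElliptic]
    [W.IsGloballyMinimal] [Fact (Nat.Prime 3)] (hX : ClassX11b W 3) (hns : ¬ Surj W 3)
    (q : ℕ) [Fact q.Prime] (h3 : 3 ∣ (W.baseChange ℚ_[q]).localTamagawaNumber ℤ_[q]) :
    W.HasSplitMultiplicativeReductionAtPrime q :=
  hasSplitMultiplicativeReductionAtPrime_of_three_dvd_of_not_shapeGamma W (Three.not_shapeGamma_of_not_surj W hX hns) q h3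

end Summit.BirchSwinnertonDyer.BirchSwinnertonDyer.Theorems

end
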